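import Summits.HodgeConjecture.HodgeCM.Model.AdelicThetaDistributionAut_1

/-! PORT of `HodgeCM/Model/AdelicThetaDistributionAut.lean` (HodgeCMPerL run 82) — part 2: continuation of `Summits.HodgeConjecture.HodgeCM.Model.AdelicThetaDistributionAut_1` (split at a top-level declaration boundary by port_pkg.py; scope re-opened below; declarations unchanged). -/

-- port_pkg: scope re-opened for this part (file-level context, then the namespace/section stack open at the cut)
set_option autoImplicit false
noncomputable section
open MulAction IsDedekindDomain NumberField.mixedEmbedding
open NumberField hiding relNormOneIdeles relNormOneRat probHaarRelNormOneQuot relNormOneInfUnits relNormOneInfToIdeles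
open scoped Matrix TensorProduct Classical SchwartzMap
open Literature.NumberTheory.Automorphic Literature.NumberTheory.Weil1964
open Literature.NumberTheory.GelbartRogawski1991 Literature.NumberTheory.GelbartRogawski1991.UnitaryDualPair
open Literature.RepresentationTheory (SeesawScalar.twist SeesawScalar.twist_apply)
open Literature.Geometry.ComplexHyperbolic.BallModel (U21 x₀)
open Literature.AlgebraicGeometry.ShimuraVarieties
open HodgeCM.Adelic HodgeCM.PerL34 HodgeCM.Model.ArchSideTerm HodgeCM.Model.ThetaDistFin
open Literature.NumberTheory.Automorphic.UnitaryGroup (cmAdelicOneEquivRelNormOne)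
namespace HodgeCM.Model
namespace ThetaAdelicSide
variable {L : CMField} {ι₁ : L →+* ℂ} (V : HermSpace3 L ι₁) (c : SeesawCtx L)
  (hGR : (cmSplittingDatum (L : Type) finProdFinEquiv (frameD V) (frameD_real V) (frameD_ne V) (dW c.D) (dW_real c.D)
    (dW_ne c.D)).CompatibleSplitting)
  (hGR₀ : (cmSplittingDatum (L : Type) (e₁) (frameD V) (frameD_real V) (frameD_ne V) (lineVec (L : Type) (dW c.D 0))
    (fun _ => dW_real c.D 0) (fun _ => dW_ne c.D 0)).CompatibleSplitting)
  (hGR₁ : (cmSplittingDatum (L : Type) (e₁) (frameD V) (frameD_real V) (frameD_ne V) (lineVec (L : Type) (dW c.D 1))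
    (fun _ => dW_real c.D 1) (fun _ => dW_ne c.D 1)).CompatibleSplitting)
  (η : CMAdelic (L : Type) (frameD V) × CMAdelic (L : Type) (dW c.D) →* ℂˣ)
  (hη : ∀ γU ∈ CMRat (L : Type) (frameD V), ∀ γ ∈ CMRat (L : Type) (dW c.D), η (γU, γ) = 1)
  (hηc : Continuous fun p => ((η p : ℂˣ) : ℂ))
  (h₁W : (∀ j, 0 < (ι₁ (dW c.D j)).re) ∨ ∀ j, (ι₁ (dW c.D j)).re < 0)
  (χ : PontryaginDual (↥(relNormOneIdeles (↥(maximalRealSubfield L)) L) ⧸ relNormOneRat (↥(maximalRealSubfield L)) L))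
include hη hηc h₁W in
/-- **`ψ₁ = psiOne χ` IS A `GoodChar` OF THE SLOT-1 RECORD** (`IsAutChar`, [Liu21, Def. 4.11]) as soon as the ONE archimedean identity
`χ(♯(t,1_f)) · torusScalar_oneG(u_t) = 1` holds on the archimedean torus — binder-2's socket hypothesis `hχ` for slot 1. -/
theorem isAutChar_psiOne
    (hχinf : ∀ t : ↥(relNormOneInfUnits (↥(maximalRealSubfield L)) L),
      ((χ (QuotientGroup.mk (relNormOneInfToIdeles (↥(maximalRealSubfield L)) L t)) : Circle) : ℂ) *
          ((torusScalar_oneG V c.D hGR hGR₀ hGR₁ (eta₁ V c.D η)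
            ((cmAdelicOneEquivRelNormOne (L : Type)).symm (relNormOneInfToIdeles (↥(maximalRealSubfield L)) L t)) : ℂˣ) : ℂ) = 1) :
    (splitLineOne V c hGR₁).IsAutChar (psiOne V c hGR hGR₀ hGR₁ η χ) :=
  ⟨isLevelTrivial_psiOne V c hGR hGR₀ hGR₁ η hηc h₁W χ, hasRationalRestriction_psiOne_one V c hGR hGR₀ hGR₁ η hη χ hχinf⟩

include hη hηc h₁W in
/-- the same from the WEIGHT identity and (Hw₁). -/
theorem isAutChar_psiOne_of_weight (w : ↥(relNormOneInfUnits (↥(maximalRealSubfield L)) L) → ℂ)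
    (hχw : ∀ t : ↥(relNormOneInfUnits (↥(maximalRealSubfield L)) L),
      ((χ (QuotientGroup.mk (relNormOneInfToIdeles (↥(maximalRealSubfield L)) L t)) : Circle) : ℂ) * w t = 1)
    (hw : ∀ t : ↥(relNormOneInfUnits (↥(maximalRealSubfield L)) L),
      w t = ((torusScalar_oneG V c.D hGR hGR₀ hGR₁ (eta₁ V c.D η)
        ((cmAdelicOneEquivRelNormOne (L : Type)).symm (relNormOneInfToIdeles (↥(maximalRealSubfield L)) L t)) : ℂˣ) : ℂ)) :
    (splitLineOne V c hGR₁).IsAutChar (psiOne V c hGR hGR₀ hGR₁ η χ) :=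
  ⟨isLevelTrivial_psiOne V c hGR hGR₀ hGR₁ η hηc h₁W χ,
    hasRationalRestriction_psiOne_one_of_weight V c hGR hGR₀ hGR₁ η hη χ w hχw hw⟩

end ThetaAdelicSide

end HodgeCM.Model

end
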